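import Summits.CriticalPhenomena.SAWScalingLimit.Theorems.SAWDevelopingMapObservableToSLEHullApproxCut
import HarnessLib

/-!
# Crux `SAWDevelopingMap.ObservableToSLE` (stmt-CriticalPhenomena-10472), line `six-class-type-ladder`,
stub T2b′ `stub_carvedReduction_squeeze`: piece (G2′), CUTTING A JORDAN DOMAIN WITH THE MARKED
POINTS ANYWHERE ON THE NEW FRONTIER (in particular ON the cross-cut: the gates)

Landing target:
`Summits/CriticalPhenomena/SAWScalingLimit/Theorems/SAWDevelopingMapObservableToSLETypeLadderCarvedReductionSqueezeCut.lean`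
(`--supports stmt-CriticalPhenomena-10472`; registered sub-goal `stub_carvedReduction_cutDomain`).

The common two-piece flat super-domain `E ⊆ D − τ` of the moving-carving squeeze is the side of two
cross-cuts of `D − τ`, each running ALONG the flat gate segment: so the marked points of `E` (the
pinned gates) lie ON the cross-cuts.  The floor line's `FloorRatio.stub_hullApproxDomain_cut` asks
for marked points off the cut (`p₀ ∉ L`, `p₁ ∉ L`) — hypotheses its proof never uses.  Here:

* `exists_remark` — **re-marking a Jordan domain**: any two distinct frontier points of a Jordan
  domain are the marked points of a Dobrushin domain with the same carrier and the same boundary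
  loop up to a parameter shift;
* `stub_carvedReduction_cutDomain` — **cutting along a cross-cut with the marks anywhere on
  `∂X`** (from `stub_hullApproxDomain_cut` applied to two auxiliary points of the boundary arc off
  the cut, then re-marked).

Sources: M. H. A. Newman, Elements of the topology of plane sets of points (1939), Ch. V §11.
-/

noncomputable section

open Set Filter Topology Metric Function
open Literature.Probability.RandomPlanarGeometry
open Literature.Topology.PlaneTopology

namespace Summit.CriticalPhenomena.SAWScalingLimit.Theorems.ObservableToSLE.TypeLadder

open Summit.CriticalPhenomena.SAWScalingLimit.Theorems.ObservableToSLE.FloorRatio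
  (side_eq_of_union stub_hullApproxDomain_cut)

/-- **Re-marking a Jordan domain.**  Two distinct frontier points `p₀ ≠ p₁` of a Jordan domain `J`
are the marked points of a Dobrushin domain with carrier `J.carrier` whose boundary loop is
`u ↦ J.boundary (u + c)` for a shift `c` (the parameter of `p₀`). [cite: Newman1939, Ch. V §11] -/
theorem exists_remark (J : JordanDomain) {p₀ p₁ : ℂ} (hp : p₀ ≠ p₁)
    (hp₀ : p₀ ∈ frontier J.carrier) (hp₁ : p₁ ∈ frontier J.carrier) :
    ∃ (D₂ : DobrushinDomain) (c : ℝ), D₂.carrier = J.carrier ∧ D₂.pt 0 = p₀ ∧ D₂.pt 1 = p₁ ∧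
      ∀ u, D₂.boundary u = J.boundary (u + c) := by
  classical
  have hp₀f : p₀ ∈ range J.boundary := by rw [J.range_boundary]; exact hp₀
  have hp₁f : p₁ ∈ range J.boundary := by rw [J.range_boundary]; exact hp₁
  obtain ⟨τ₀, hτ₀⟩ := hp₀f
  obtain ⟨τ₁, hτ₁⟩ := hp₁f
  have hper := J.periodic_boundary
  have hτ : ¬ ∃ z : ℤ, τ₁ - τ₀ = z := by
    rintro ⟨z, hz⟩
    have h1 : J.boundary τ₁ = J.boundary τ₀ := by
      rw [show τ₁ = τ₀ + z by linarith]
      simpa using hper.int_mul z τ₀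
    exact hp (by rw [← hτ₀, ← hτ₁, h1])
  have hfract : 0 < Int.fract (τ₁ - τ₀) := by
    rcases (Int.fract_nonneg (τ₁ - τ₀)).lt_or_eq with h | h
    · exact h
    · exfalso
      refine hτ ⟨⌊τ₁ - τ₀⌋, ?_⟩
      have := Int.fract_add_floor (τ₁ - τ₀)
      linarith
  let D₂ : DobrushinDomain :=
    { carrier := J.carrier
      boundary := fun u ↦ J.boundary (u + τ₀)
      isOpen := J.isOpen
      isBounded := J.isBounded
      isConnected := J.isConnected
      continuous_boundary := J.continuous_boundary.comp (continuous_id.add continuous_const)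
      periodic_boundary := fun u ↦ by
        show J.boundary (u + 1 + τ₀) = J.boundary (u + τ₀)
        rw [add_right_comm]
        exact hper (u + τ₀)
      injOn_boundary := hper.injOn_shift J.injOn_boundary τ₀
      range_boundary := by rw [range_comp_add_right J.boundary τ₀, J.range_boundary]
      mark := ![0, Int.fract (τ₁ - τ₀)]
      strictMono_mark := by
        refine Fin.strictMono_iff_lt_succ.2 fun k ↦ ?_
        fin_cases k
        simpa using hfract
      mark_mem := fun k ↦ by
        fin_cases k
        · simp
        · exact ⟨Int.fract_nonneg (τ₁ - τ₀), Int.fract_lt_one (τ₁ - τ₀)⟩ }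
  refine ⟨D₂, τ₀, rfl, ?_, ?_, fun u ↦ rfl⟩
  · show J.boundary (0 + τ₀) = p₀
    rw [zero_add, hτ₀]
  · show J.boundary (Int.fract (τ₁ - τ₀) + τ₀) = p₁
    have : J.boundary (Int.fract (τ₁ - τ₀) + τ₀) = J.boundary τ₁ := by
      rw [Int.fract, show τ₁ - τ₀ - (⌊τ₁ - τ₀⌋ : ℝ) + τ₀ = τ₁ - (⌊τ₁ - τ₀⌋ : ℝ) * 1 by ring]
      exact hper.sub_int_mul_eq ⌊τ₁ - τ₀⌋
    rw [this, hτ₁]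

/-- **Registered sub-goal `stub_carvedReduction_cutDomain`** (crux item stmt-CriticalPhenomena-10472,
stub T2b′ `stub_carvedReduction_squeeze`, piece (G2′) CROSS-CUT SIDES WITH MARKS ANYWHERE): let `L` be
a cross-cut of the Jordan domain `D₁` from `boundary s` to `boundary t` (`s < t < s + 1`) and
`D₁ ∖ L = X ⊔ Y` with `X`, `Y` open and nonempty; let `p₀ ≠ p₁` be ANY two points of `∂X`
(possibly on `L`).  Then `X` is the carrier of a Dobrushin domain with marked points `p₀`, `p₁`.
(`FloorRatio.stub_hullApproxDomain_cut` with its unused hypotheses `pᵢ ∉ L` removed: apply it to two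
auxiliary interior points of the boundary arc of `∂X`, which are off `L`, and re-mark.)
[cite: Newman1939, Ch. V §11, Thms. 11·7 and 11·8, pp. 94–95] -/
theorem stub_carvedReduction_cutDomain :
    ∀ (D₁ : JordanDomain) (L : Set ℂ) (s t : ℝ) (X Y : Set ℂ) (p₀ p₁ : ℂ),
      s < t → t < s + 1 → D₁.IsCrosscut L (D₁.boundary s) (D₁.boundary t) →
      IsOpen X → IsOpen Y → Disjoint X Y → X.Nonempty → Y.Nonempty →
      X ∪ Y = D₁.carrier \ L → p₀ ≠ p₁ →
      p₀ ∈ closure X → p₀ ∉ X → p₁ ∈ closure X → p₁ ∉ X →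
      ∃ D₂ : DobrushinDomain, D₂.carrier = X ∧ D₂.pt 0 = p₀ ∧ D₂.pt 1 = p₁ := by
  intro D₁ L s t X Y p₀ p₁ hst hts hL hXo hYo hXY hXne hYne hunion hp hp₀ hp₀X hp₁ hp₁X
  classical
  obtain ⟨s', t', hs't', ht's', hends, -, hfr⟩ :=
    side_eq_of_union D₁ hst hts hL hXo hYo hXY hXne hYne hunion
  have hLD : L \ {D₁.boundary s, D₁.boundary t} ⊆ D₁.carrier := hL.2.2.2.2
  -- two auxiliary points of the boundary arc, off the cut
  set u₁ : ℝ := s' + (t' - s') / 3 with hu₁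
  set u₂ : ℝ := s' + 2 * ((t' - s') / 3) with hu₂
  have hu₁I : u₁ ∈ Ioo s' t' := ⟨by rw [hu₁]; linarith, by rw [hu₁]; linarith⟩
  have hu₂I : u₂ ∈ Ioo s' t' := ⟨by rw [hu₂]; linarith, by rw [hu₂]; linarith⟩
  have hinj := D₁.injOn_boundary_Ico s'
  have hmemIco : ∀ {u}, u ∈ Ioo s' t' → u ∈ Ico s' (s' + 1) := fun hu ↦ ⟨hu.1.le, by linarith [hu.2]⟩
  have hs'I : s' ∈ Ico s' (s' + 1) := ⟨le_rfl, by linarith⟩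
  have ht'I : t' ∈ Ico s' (s' + 1) := ⟨hs't'.le, ht's'⟩
  -- interior arc points are frontier points of `X`, not in `X`, not on `L`
  have haux : ∀ {u}, u ∈ Ioo s' t' →
      D₁.boundary u ∈ closure X ∧ D₁.boundary u ∉ X ∧ D₁.boundary u ∉ L := by
    intro u hu
    have hfrX : D₁.boundary u ∈ frontier X := by
      rw [hfr]; exact Or.inr ⟨u, ⟨hu.1.le, hu.2.le⟩, rfl⟩
    have hfrX' : frontier X = closure X \ X := by rw [frontier, hXo.interior_eq]
    rw [hfrX'] at hfrX
    refine ⟨hfrX.1, hfrX.2, fun huL ↦ ?_⟩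
    -- a point of `L` on `∂D₁` is an endpoint of `L`, i.e. `boundary s'` or `boundary t'`
    have hbd : D₁.boundary u ∈ ({D₁.boundary s, D₁.boundary t} : Set ℂ) := by
      by_contra hne
      exact Set.disjoint_left.1 D₁.disjoint_carrier_frontier (hLD ⟨huL, hne⟩)
        (D₁.boundary_mem_frontier u)
    have hbd' : D₁.boundary u = D₁.boundary s' ∨ D₁.boundary u = D₁.boundary t' := by
      rcases hends with ⟨h1, h2⟩ | ⟨h1, h2⟩
      · rw [h1, h2]; simpa using hbd
      · rw [h1, h2]
        rcases hbd with h | h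
        · exact Or.inr h
        · exact Or.inl h
    rcases hbd' with h | h
    · have := hinj (hmemIco hu) hs'I h
      exact absurd this (ne_of_gt hu.1)
    · have := hinj (hmemIco hu) ht'I h
      exact absurd this (ne_of_lt hu.2)
  obtain ⟨hc₁, hX₁, hL₁⟩ := haux hu₁I
  obtain ⟨hc₂, hX₂, hL₂⟩ := haux hu₂I
  have hne12 : D₁.boundary u₁ ≠ D₁.boundary u₂ := by
    intro h
    have := hinj (hmemIco hu₁I) (hmemIco hu₂I) h
    rw [hu₁, hu₂] at this
    linarith
  -- a Dobrushin domain with carrier `X` (auxiliary marks), then re-mark at `p₀`, `p₁`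
  obtain ⟨D₃, hD₃, -, -⟩ := stub_hullApproxDomain_cut D₁ L s t X Y (D₁.boundary u₁) (D₁.boundary u₂)
    hst hts hL hXo hYo hXY hXne hYne hunion hne12 hc₁ hX₁ hL₁ hc₂ hX₂ hL₂
  have hfrX' : frontier X = closure X \ X := by rw [frontier, hXo.interior_eq]
  have hp₀fr : p₀ ∈ frontier D₃.carrier := by rw [hD₃, hfrX']; exact ⟨hp₀, hp₀X⟩
  have hp₁fr : p₁ ∈ frontier D₃.carrier := by rw [hD₃, hfrX']; exact ⟨hp₁, hp₁X⟩
  obtain ⟨D₂, -, hcar, h0, h1, -⟩ := exists_remark D₃.toJordanDomain hp hp₀fr hp₁fr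
  exact ⟨D₂, hcar.trans hD₃, h0, h1⟩

end Summit.CriticalPhenomena.SAWScalingLimit.Theorems.ObservableToSLE.TypeLadder

end
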